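import Mathlib
import HarnessLib
import Summits.ABC.ABC.Theses.CongruentialReceptacle
import Summits.ABC.ABC.Theorems.CongruentialReceptacleTameLocalReceptacleQLCertificate
import Summits.ABC.ABC.Theorems.CongruentialReceptacleTameLocalReceptacleQLMatching

/-!
# Crux `TameLocalReceptacle` (stmt-ABC-14354): the QUADRATIC-LOCAL receptacle is false (unconditional)

Negative theorem for the crux chain of route `CongruentialReceptacle` (lead `prover-line-stmt-ABC-14354-0`).
The crux lets the table entry at `p ∣ abc` depend ARBITRARILY on the unit residues `(a′, b′, c′ mod p)`;
the branch-(i) identities it abstracts (Kummer classes of `a, b, c, Δ, j`, local Tate pairings,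
`E[ℓⁿ]|G_{ℚ_p}` of the Frey–Tate curve) see them at a prime `p ≢ 1 (mod ℓ)` only through QUADRATIC
CHARACTERS (`ℚ_p^×/(ℚ_p^×)^{ℓⁿ} = ⟨p⟩` there, so Kummer classes and cup products reduce to valuations;
the one residue-sensitive invariant of the Tate curve is the unramified quadratic twist, a Legendre
symbol of the partner residue).  `not_tameLocalReceptacle_quadraticLocal` refutes the crux for ALL
table families that are quadratic-local at the odd primes `p` with `ℓ ∤ p − 1` (arbitrary at
`p ≡ 1 (mod ℓ)`; the refuter takes `ℓ` above every member of the certificate).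
Certificate (`ql_certificate`): `T⁻ = (x, y, 32w)`, `T₁⁺ = (x, Y, 50w)`, `T₂⁺ = (X, y, 16W)`,
`X = r⁴`, `W = q⁴`, `Y = s⁴`; the multipliers are squares up to the common factor `2`, so the shared
atoms have equal Legendre symbols (`ql_match_x/y/w`) and cancel EXACTLY; what is left is
`t(s;0,4,0) ≥ c₁(2−ε) log s`, three bounded atoms at `2`, `5`, nonnegative fourth-power atoms, against
`≤ 3c₃` after congruence-to-equality at a prime `ℓ` above everything.  Axioms standard (Dirichlet for
`s ≡ 2 (mod 9)` is Mathlib's `Nat.forall_exists_prime_gt_and_zmodEq`).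
-/

-- `Summit.<Summit>.<Problem>` is the mandated summit-side namespace (CONVENTIONS §2); for the
-- single-conjunct summit `ABC` the two coincide, so the duplicate `ABC.ABC` is deliberate.
set_option linter.dupNamespace false

namespace Summit.ABC.ABC.Theorems.TameLocalReceptacle

open NumberTheorySymbols Literature.NumberTheory.DiophantineGeometry Literature.NumberTheory.QuadraticFields
open Summit.ABC.ABC.Theorems.CompactBalanceTransfer.Negative

-- short local names for the valuation one-liners of the lemma file
local notation "ndvd" => not_dvd_of_coprime'
local notation "fz" => factorization_eq_zero_of_not_dvd'
local notation "fpp" => factorization_prime_pow_self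
local notation "fml" => factorization_mul_of_not_dvd_left
local notation "fmr" => factorization_mul_of_not_dvd_right

set_option maxHeartbeats 800000 in
-- one long but linear bookkeeping proof (three triples × three members); default heartbeats are marginal
/-- **Core refutation.** For every balance `κ ≤ 2⁻²⁵`, every `ε < 2` and all constants `c₁ > 0`, `c₁'`,
`c₃`, `m₀` there is no family of integer tables in the crux's windows, QUADRATIC-LOCAL at the odd primes
`p` with `ℓ ∤ p − 1`, whose sum over `p ∣ abc` is `≡ B (mod ℓⁿ)`, `|B| ≤ c₃`, on every `κ`-balanced
abc-triple prime to `ℓ` (all prime powers `ℓⁿ ≥ m₀`, `ℓ ≥ 5`). [folklore] -/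
theorem tameLocal_quadraticLocal_false (κ ε c₁ c₁' c₃ : ℝ) (hκ : κ ≤ 1 / 2 ^ 25) (hε : ε < 2)
    (hc₁ : 0 < c₁) (m₀ : ℕ)
    (H : ∀ ℓ n : ℕ, ℓ.Prime → 5 ≤ ℓ → m₀ ≤ ℓ ^ n →
      ∃ t : ℕ → ℕ → ℕ → ℕ → ℕ → ℕ → ℕ → ℤ,
        (∀ p i j k r s z : ℕ, p.Prime →
          c₁ * (2 * ((i + j + k : ℕ) : ℝ) - 6 - ε) * Real.log p ≤ (t p i j k r s z : ℝ) ∧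
          |(t p i j k r s z : ℝ)| ≤ c₁' * (((i + j + k : ℕ) : ℝ) + 1) * Real.log p) ∧
        (∀ p : ℕ, p.Prime → p ≠ 2 → ¬ ℓ ∣ p - 1 → ∀ i j k r s z r' s' z' : ℕ,
          J((r : ℤ) | p) = J((r' : ℤ) | p) → J((s : ℤ) | p) = J((s' : ℤ) | p) →
          J((z : ℤ) | p) = J((z' : ℤ) | p) → t p i j k r s z = t p i j k r' s' z') ∧
        ∀ a b c : ℕ, IsABCTriple a b c → κ * (c : ℝ) ≤ (a : ℝ) → κ * (c : ℝ) ≤ (b : ℝ) →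
          ¬ ℓ ∣ a * b * c → ∃ B : ℤ, |(B : ℝ)| ≤ c₃ ∧
            (∑ p ∈ (a * b * c).primeFactors, t p (a.factorization p) (b.factorization p)
              (c.factorization p) (a / p ^ a.factorization p % p) (b / p ^ b.factorization p % p)
              (c / p ^ c.factorization p % p)) ≡ B [ZMOD ((ℓ ^ n : ℕ) : ℤ)]) :
    False := by
  /- Step 0: constants and the certificate. -/
  set K : ℝ := max c₁' 0 with hK
  have hK0 : 0 ≤ K := le_max_right _ _
  have hK1 : c₁' ≤ K := le_max_left _ _
  set D : ℝ := c₁ * (2 - ε) with hD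
  have hD0 : 0 < D := mul_pos hc₁ (by linarith)
  set C₀ : ℝ := (4 + ε) * c₁ * Real.log (2 : ℕ) + (2 + ε) * c₁ * Real.log (5 : ℕ) +
    6 * K * Real.log (2 : ℕ) with hC₀
  set A : ℝ := (3 * |c₃| + |C₀| + 1) / D with hA
  obtain ⟨s, q, r, X, W, y, Y, w, x, hS₀, hs, hX, hW, hY, hyX, hw, hx, hxY, hXW, hWX, h81, h256,
    hr0, hw0, hx0, hy0, hr2, hq2, hs2, hw2, hx2, hy2, hy3, hx5, hw5, hs5, cop_r_q, cop_s_y, cop_s_w,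
    cop_x_y, cop_x_Y, cop_X_y⟩ := ql_certificate (⌈Real.exp A⌉₊ + 1)
  have hs0 : 0 < s := hs.pos
  have hsA : A < Real.log s := by
    rw [Real.lt_log_iff_exp_lt (by exact_mod_cast hs0)]
    have : ((⌈Real.exp A⌉₊ + 1 : ℕ) : ℝ) ≤ (s : ℝ) := by exact_mod_cast hS₀
    push_cast at this; linarith [Nat.le_ceil (Real.exp A)]
  have hthr : 3 * |c₃| + |C₀| + 1 < D * Real.log s := by
    rw [hA] at hsA
    have := (div_lt_iff₀ hD0).mp hsA
    linarith [mul_comm (Real.log s) D]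
  -- positivity and the derived coprimalities
  have hX0 : 0 < X := by rw [hX]; positivity
  have hW0 : 0 < W := lt_trans hX0 hXW
  have hY0 : 0 < Y := by rw [hY]; positivity
  have h32w : 0 < 32 * w := by omega
  have h50w : 0 < 50 * w := by omega
  have h16W : 0 < 16 * W := by omega
  have hw0' : w ≠ 0 := hw0.ne'
  have hW0' : W ≠ 0 := hW0.ne'
  have cop_x_32w : Nat.Coprime x (32 * w) := by rw [← hx]; exact Nat.coprime_self_add_right.mpr cop_x_y
  have cop_y_32w : Nat.Coprime y (32 * w) := hx ▸ Nat.coprime_add_self_right.mpr cop_x_y.symm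
  have cop_x_50w : Nat.Coprime x (50 * w) := by rw [← hxY]; exact Nat.coprime_self_add_right.mpr cop_x_Y
  have cop_Y_50w : Nat.Coprime Y (50 * w) := hxY ▸ Nat.coprime_add_self_right.mpr cop_x_Y.symm
  have cop_X_16W : Nat.Coprime X (16 * W) := by
    rw [← hyX, add_comm]; exact Nat.coprime_self_add_right.mpr cop_X_y
  have cop_y_16W : Nat.Coprime y (16 * W) := by rw [← hyX]; exact Nat.coprime_self_add_right.mpr cop_X_y.symm
  have h2w : ¬ 2 ∣ w := by omega
  have h5w : ¬ 5 ∣ w := by omega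
  have cop_2_w : Nat.Coprime 2 w := (Nat.Prime.coprime_iff_not_dvd Nat.prime_two).mpr h2w
  have cop_32_w : Nat.Coprime 32 w := by
    rw [show (32 : ℕ) = 2 ^ 5 by norm_num]; exact Nat.Coprime.pow_left 5 cop_2_w
  have cop_50_w : Nat.Coprime 50 w := by
    rw [show (50 : ℕ) = 2 * 5 ^ 2 by norm_num]
    exact cop_2_w.mul_left (((Nat.Prime.coprime_iff_not_dvd (by norm_num)).mpr h5w).pow_left 2)
  -- balance dispatcher
  have bal : ∀ {a c : ℕ}, c ≤ 2 ^ 25 * a → κ * (c : ℝ) ≤ (a : ℝ) := fun {a c} h => by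
    have h' : (c : ℝ) ≤ 2 ^ 25 * (a : ℝ) := by exact_mod_cast h
    calc κ * (c : ℝ) ≤ (1 / 2 ^ 25) * (c : ℝ) := mul_le_mul_of_nonneg_right hκ (Nat.cast_nonneg c)
      _ ≤ (a : ℝ) := by rw [one_div, inv_mul_le_iff₀ (by positivity)]; exact h'
  /- Step 1: a-priori bounds and the modulus ℓ above everything. -/
  set P₃ : ℕ := x * y * (32 * w) with hP₃
  set P₁ : ℕ := x * Y * (50 * w) with hP₁
  set P₂ : ℕ := X * y * (16 * W) with hP₂
  have hP₃0 : 0 < P₃ := by positivity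
  have hP₁0 : 0 < P₁ := by positivity
  have hP₂0 : 0 < P₂ := by positivity
  set Z₃ : ℝ := ∑ p ∈ (x * y * (32 * w)).primeFactors,
    K * (((x.factorization p + y.factorization p + (32 * w).factorization p : ℕ) : ℝ) + 1) *
      Real.log p with hZ₃
  set Z₁ : ℝ := ∑ p ∈ (x * Y * (50 * w)).primeFactors,
    K * (((x.factorization p + Y.factorization p + (50 * w).factorization p : ℕ) : ℝ) + 1) *
      Real.log p with hZ₁
  set Z₂ : ℝ := ∑ p ∈ (X * y * (16 * W)).primeFactors,
    K * (((X.factorization p + y.factorization p + (16 * W).factorization p : ℕ) : ℝ) + 1) *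
      Real.log p with hZ₂
  have hlogp : ∀ p : ℕ, 0 ≤ Real.log p := fun p => Real.log_natCast_nonneg p
  have hZ₃0 : 0 ≤ Z₃ := Finset.sum_nonneg fun p _ => mul_nonneg (mul_nonneg hK0 (by positivity)) (hlogp p)
  have hZ₁0 : 0 ≤ Z₁ := Finset.sum_nonneg fun p _ => mul_nonneg (mul_nonneg hK0 (by positivity)) (hlogp p)
  have hZ₂0 : 0 ≤ Z₂ := Finset.sum_nonneg fun p _ => mul_nonneg (mul_nonneg hK0 (by positivity)) (hlogp p)
  set Zt : ℝ := Z₁ + Z₂ + Z₃ with hZt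
  obtain ⟨ℓ, hℓge, hℓp⟩ := Nat.exists_infinite_primes (P₁ + P₂ + P₃ + m₀ + 5 + ⌈Zt + |c₃|⌉₊ + 1)
  have h5 : 5 ≤ ℓ := by omega
  have hm₀ : m₀ ≤ ℓ ^ 1 := by rw [pow_one]; omega
  have hℓR : Zt + |c₃| < ((ℓ ^ 1 : ℕ) : ℝ) := by
    have h1 : ((⌈Zt + |c₃|⌉₊ : ℕ) : ℝ) + 1 ≤ (ℓ : ℝ) := by
      exact_mod_cast (show ⌈Zt + |c₃|⌉₊ + 1 ≤ ℓ by omega)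
    rw [pow_one]; linarith [Nat.le_ceil (Zt + |c₃|)]
  have hnd₃ : ¬ ℓ ∣ P₃ := Nat.not_dvd_of_pos_of_lt hP₃0 (by omega)
  have hnd₁ : ¬ ℓ ∣ P₁ := Nat.not_dvd_of_pos_of_lt hP₁0 (by omega)
  have hnd₂ : ¬ ℓ ∣ P₂ := Nat.not_dvd_of_pos_of_lt hP₂0 (by omega)
  -- every prime factor of a member is below ℓ, hence ℓ ∤ p - 1
  have small : ∀ {p n : ℕ}, p ∈ n.primeFactors → n < ℓ → ¬ ℓ ∣ p - 1 := by
    intro p n hp hn hd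
    have hp2 := (Nat.prime_of_mem_primeFactors hp).two_le
    have hple : p ≤ n := Nat.le_of_mem_primeFactors hp
    have := Nat.le_of_dvd (by omega) hd
    omega
  /- Step 2: the table at modulus ℓ and the three triples. -/
  obtain ⟨t, ht, hQL, hT⟩ := H ℓ 1 hℓp h5 hm₀
  have T₃ : IsABCTriple x y (32 * w) := ⟨hx0, hy0, hx, cop_x_y⟩
  have T₁ : IsABCTriple x Y (50 * w) := ⟨hx0, hY0, hxY, cop_x_Y⟩
  have T₂ : IsABCTriple X y (16 * W) := ⟨hX0, hy0, by omega, cop_X_y⟩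
  obtain ⟨B₃, hB₃, hc₃'⟩ := hT x y (32 * w) T₃ (bal (by omega)) (bal (by omega)) hnd₃
  obtain ⟨B₁, hB₁, hc₁'⟩ := hT x Y (50 * w) T₁ (bal (by omega)) (bal (by omega)) hnd₁
  obtain ⟨B₂, hB₂, hc₂'⟩ := hT X y (16 * W) T₂ (bal (by omega)) (bal (by omega)) hnd₂
  -- the three summands as functions of the prime
  let G₃ : ℕ → ℤ := fun p => t p (x.factorization p) (y.factorization p) ((32 * w).factorization p)
    (x / p ^ x.factorization p % p) (y / p ^ y.factorization p % p)
    (32 * w / p ^ (32 * w).factorization p % p)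
  let G₁ : ℕ → ℤ := fun p => t p (x.factorization p) (Y.factorization p) ((50 * w).factorization p)
    (x / p ^ x.factorization p % p) (Y / p ^ Y.factorization p % p)
    (50 * w / p ^ (50 * w).factorization p % p)
  let G₂ : ℕ → ℤ := fun p => t p (X.factorization p) (y.factorization p) ((16 * W).factorization p)
    (X / p ^ X.factorization p % p) (y / p ^ y.factorization p % p)
    (16 * W / p ^ (16 * W).factorization p % p)
  -- congruence to equality
  have hKt : ∀ p i j k r s z : ℕ, p.Prime →
      |(t p i j k r s z : ℝ)| ≤ K * (((i + j + k : ℕ) : ℝ) + 1) * Real.log p := by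
    intro p i j k r s z hp
    refine ((ht p i j k r s z hp).2).trans ?_
    exact mul_le_mul_of_nonneg_right (mul_le_mul_of_nonneg_right hK1 (by positivity))
      (Real.log_natCast_nonneg p)
  have hc₃abs := le_abs_self c₃
  have hE₃ : (∑ p ∈ P₃.primeFactors, G₃ p) = B₃ :=
    eq_of_modEq_of_abs_le hc₃' (X := Z₃) (Y := c₃) (abs_tableSum7_le hKt x y (32 * w)) hB₃
      (by linarith only [hℓR, hZ₁0, hZ₂0, hZ₃0, hc₃abs])
  have hE₁ : (∑ p ∈ P₁.primeFactors, G₁ p) = B₁ :=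
    eq_of_modEq_of_abs_le hc₁' (X := Z₁) (Y := c₃) (abs_tableSum7_le hKt x Y (50 * w)) hB₁
      (by linarith only [hℓR, hZ₁0, hZ₂0, hZ₃0, hc₃abs])
  have hE₂ : (∑ p ∈ P₂.primeFactors, G₂ p) = B₂ :=
    eq_of_modEq_of_abs_le hc₂' (X := Z₂) (Y := c₃) (abs_tableSum7_le hKt X y (16 * W)) hB₂
      (by linarith only [hℓR, hZ₁0, hZ₂0, hZ₃0, hc₃abs])
  /- Step 3: splitting the three sums over the members. -/
  have e₃ : ∑ p ∈ P₃.primeFactors, G₃ p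
      = ∑ p ∈ x.primeFactors, G₃ p + ∑ p ∈ y.primeFactors, G₃ p + (G₃ 2 + ∑ p ∈ w.primeFactors, G₃ p) := by
    rw [hP₃, sum_primeFactors_split3 G₃ hx0 hy0 h32w cop_x_y cop_x_32w cop_y_32w,
      sum_primeFactors_split2 G₃ (by norm_num) hw0 cop_32_w, show (32 : ℕ) = 2 ^ 5 by norm_num,
      sum_primeFactors_pow_eq G₃ Nat.prime_two (by norm_num)]
  have e₁ : ∑ p ∈ P₁.primeFactors, G₁ p
      = ∑ p ∈ x.primeFactors, G₁ p + G₁ s + (G₁ 2 + G₁ 5 + ∑ p ∈ w.primeFactors, G₁ p) := by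
    rw [hP₁, sum_primeFactors_split3 G₁ hx0 hY0 h50w cop_x_Y cop_x_50w cop_Y_50w, hY,
      sum_primeFactors_pow_eq G₁ hs (by norm_num),
      sum_primeFactors_split2 G₁ (by norm_num) hw0 cop_50_w, show (50 : ℕ) = 2 ^ 1 * 5 ^ 2 by norm_num,
      sum_primeFactors_split2 G₁ (by norm_num) (by norm_num) (by norm_num : Nat.Coprime (2 ^ 1) (5 ^ 2)),
      sum_primeFactors_pow_eq G₁ Nat.prime_two one_ne_zero,
      sum_primeFactors_pow_eq G₁ (by norm_num : Nat.Prime 5) (by norm_num)]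
  have e₂ : ∑ p ∈ P₂.primeFactors, G₂ p
      = ∑ p ∈ X.primeFactors, G₂ p + ∑ p ∈ y.primeFactors, G₂ p + ∑ p ∈ (16 * W).primeFactors, G₂ p := by
    rw [hP₂, sum_primeFactors_split3 G₂ hX0 hy0 h16W cop_X_y cop_X_16W cop_y_16W]
  /- Step 4: the shared atoms cancel EXACTLY (quadratic locality). -/
  -- sizes: all members are below ℓ
  have hxP : x ≤ P₃ := by rw [hP₃, mul_assoc]; exact Nat.le_mul_of_pos_right x (by positivity)
  have hyP : y ≤ P₃ := by
    rw [hP₃, mul_comm x y, mul_assoc]; exact Nat.le_mul_of_pos_right y (by positivity)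
  have hwP : w ≤ P₃ := (Nat.le_mul_of_pos_left w (by norm_num : 0 < 32)).trans
    (hP₃ ▸ Nat.le_mul_of_pos_left _ (by positivity))
  have hxℓ : x < ℓ := by omega
  have hyℓ : y < ℓ := by omega
  have hwℓ : w < ℓ := by omega
  -- (a) the member `x` (A-position): partners `Y ≡ 50w` vs `y ≡ 32w` (mod p)
  have mx : ∑ p ∈ x.primeFactors, G₁ p = ∑ p ∈ x.primeFactors, G₃ p := by
    refine Finset.sum_congr rfl fun p hp => ?_
    have pp := Nat.prime_of_mem_primeFactors hp
    have hpx := Nat.dvd_of_mem_primeFactors hp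
    have hp2 : p ≠ 2 := fun h => by subst h; omega
    have hp5 : p ≠ 5 := fun h => by subst h; omega
    obtain ⟨jYy, j5032⟩ := ql_match_x pp hp2 hp5 hpx hx hxY
    show t p _ _ _ _ _ _ = t p _ _ _ _ _ _
    rw [fz (ndvd pp cop_x_Y hpx), fz (ndvd pp cop_x_y hpx), fz (ndvd pp cop_x_50w hpx),
      fz (ndvd pp cop_x_32w hpx)]
    refine hQL p pp hp2 (small hp hxℓ) _ _ _ _ _ _ _ _ _ rfl ?_ ?_
    · rw [pow_zero, Nat.div_one, Nat.div_one, jacobiSym_natCast_mod, jacobiSym_natCast_mod, jYy]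
    · rw [pow_zero, Nat.div_one, Nat.div_one, jacobiSym_natCast_mod, jacobiSym_natCast_mod, j5032]
  -- (b) the member `y` (B-position): partners `X = r⁴` vs `x ≡ 32w`, `18w ≡ s⁴` (mod p)
  have my : ∑ p ∈ y.primeFactors, G₂ p = ∑ p ∈ y.primeFactors, G₃ p := by
    refine Finset.sum_congr rfl fun p hp => ?_
    have pp := Nat.prime_of_mem_primeFactors hp
    have hpy := Nat.dvd_of_mem_primeFactors hp
    have hp2 : p ≠ 2 := fun h => by subst h; omega
    have hp3 : p ≠ 3 := fun h => by subst h; omega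
    have hpr : ¬ p ∣ r := fun h => ndvd pp cop_X_y.symm hpy (by rw [hX]; exact dvd_pow h (by norm_num))
    have hpq : ¬ p ∣ q := fun h =>
      ndvd pp cop_y_16W hpy (by rw [hW]; exact Dvd.dvd.mul_left (dvd_pow h (by norm_num)) 16)
    have hps : ¬ p ∣ s := fun h => ndvd pp cop_s_y h hpy
    obtain ⟨jX, jx, j16W, j32⟩ := ql_match_y pp hp2 hp3 hpy hX hW hY hx hw hpr hpq hps
    show t p _ _ _ _ _ _ = t p _ _ _ _ _ _
    rw [fz (ndvd pp cop_X_y.symm hpy), fz (ndvd pp cop_x_y.symm hpy), fz (ndvd pp cop_y_16W hpy),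
      fz (ndvd pp cop_y_32w hpy)]
    refine hQL p pp hp2 (small hp hyℓ) _ _ _ _ _ _ _ _ _ ?_ rfl ?_
    · rw [pow_zero, Nat.div_one, Nat.div_one, jacobiSym_natCast_mod, jacobiSym_natCast_mod, jX, jx]
    · rw [pow_zero, Nat.div_one, Nat.div_one, jacobiSym_natCast_mod, jacobiSym_natCast_mod, j16W, j32]
  -- (c) the cofactor `w` of the C-members `50w` vs `32w`: same partners, unit residues `50w'` vs `32w'`
  have mw : ∑ p ∈ w.primeFactors, G₁ p = ∑ p ∈ w.primeFactors, G₃ p := by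
    refine Finset.sum_congr rfl fun p hp => ?_
    have pp := Nat.prime_of_mem_primeFactors hp
    have hpw := Nat.dvd_of_mem_primeFactors hp
    have hp2 : p ≠ 2 := fun h => by subst h; exact h2w hpw
    have hp5 : p ≠ 5 := fun h => by subst h; exact h5w hpw
    obtain ⟨jYy, junit⟩ := ql_match_w pp hp2 hp5 hpw hw
    show t p _ _ _ _ _ _ = t p _ _ _ _ _ _
    rw [fz (ndvd pp cop_Y_50w.symm (Dvd.dvd.mul_left hpw 50)),
      fz (ndvd pp cop_y_32w.symm (Dvd.dvd.mul_left hpw 32)),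
      fml (by norm_num) hw0' (ndvd pp cop_50_w.symm hpw), fml (by norm_num) hw0' (ndvd pp cop_32_w.symm hpw)]
    refine hQL p pp hp2 (small hp hwℓ) _ _ _ _ _ _ _ _ _ rfl ?_ ?_
    · rw [pow_zero, Nat.div_one, Nat.div_one, jacobiSym_natCast_mod, jacobiSym_natCast_mod, jYy]
    · rw [jacobiSym_natCast_mod, jacobiSym_natCast_mod, junit]
  /- Step 5: the unmatched atoms. -/
  have e4 : ∀ p : ℕ, c₁ * (2 * ((4 : ℕ) : ℝ) - 6 - ε) * Real.log p = D * Real.log p := by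
    intro p; rw [hD]; push_cast; ring
  -- the gain at `s`: datum of T₁⁺ has exponents (0, 4, 0)
  have hsx : ¬ s ∣ x := fun h => ndvd hs cop_x_Y h (by rw [hY]; exact dvd_pow_self s (by norm_num))
  have hs50w : ¬ s ∣ 50 * w := fun h => ndvd hs cop_Y_50w (by rw [hY]; exact dvd_pow_self s (by norm_num)) h
  have hYs : Y.factorization s = 4 := by rw [hY, fpp hs]
  have low_s : D * Real.log s ≤ (G₁ s : ℝ) := by
    have h := (ht s (x.factorization s) (Y.factorization s) ((50 * w).factorization s)
      (x / s ^ x.factorization s % s) (Y / s ^ Y.factorization s % s)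
      (50 * w / s ^ (50 * w).factorization s % s) hs).1
    have hexp : ((x.factorization s + Y.factorization s + (50 * w).factorization s : ℕ) : ℝ)
        = ((4 : ℕ) : ℝ) := by rw [fz hsx, fz hs50w, hYs]
    rw [hexp, e4 s] at h
    exact h
  -- T₁⁺ at 2: exponents (0, 0, 1)
  have h2x : ¬ 2 ∣ x := by omega
  have h2Y : ¬ 2 ∣ Y := ndvd Nat.prime_two cop_Y_50w.symm ⟨25 * w, by ring⟩
  have h2y : ¬ 2 ∣ y := by omega
  have f50w2 : (50 * w).factorization 2 = 1 := by
    rw [fmr (by norm_num) hw0' h2w, show (50 : ℕ) = 2 ^ 1 * 25 by norm_num,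
      fmr (by norm_num) (by norm_num) (by norm_num), fpp Nat.prime_two]
  have low_2 : -((4 + ε) * c₁ * Real.log (2 : ℕ)) ≤ (G₁ 2 : ℝ) := by
    have h := (ht 2 (x.factorization 2) (Y.factorization 2) ((50 * w).factorization 2)
      (x / 2 ^ x.factorization 2 % 2) (Y / 2 ^ Y.factorization 2 % 2)
      (50 * w / 2 ^ (50 * w).factorization 2 % 2) Nat.prime_two).1
    have hexp : ((x.factorization 2 + Y.factorization 2 + (50 * w).factorization 2 : ℕ) : ℝ) = 1 := by
      rw [fz h2x, fz h2Y, f50w2]; norm_num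
    rw [hexp] at h
    have h' : c₁ * (2 * (1 : ℝ) - 6 - ε) * Real.log (2 : ℕ) ≤ (G₁ 2 : ℝ) := h
    have e : c₁ * (2 * (1 : ℝ) - 6 - ε) * Real.log (2 : ℕ) = -((4 + ε) * c₁ * Real.log (2 : ℕ)) := by ring
    linarith
  -- T₁⁺ at 5: exponents (0, 0, 2)
  have h5x : ¬ 5 ∣ x := by omega
  have h5Y : ¬ 5 ∣ Y := by
    rw [hY]; intro h
    have h1 : 5 ∣ s := Nat.prime_five.dvd_of_dvd_pow h
    exact hs5 ((Nat.prime_dvd_prime_iff_eq Nat.prime_five hs).mp h1).symm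
  have f50w5 : (50 * w).factorization 5 = 2 := by
    rw [fmr (by norm_num) hw0' h5w, show (50 : ℕ) = 2 * 5 ^ 2 by norm_num,
      fml (by norm_num) (by norm_num) (by norm_num), fpp Nat.prime_five]
  have low_5 : -((2 + ε) * c₁ * Real.log (5 : ℕ)) ≤ (G₁ 5 : ℝ) := by
    have h := (ht 5 (x.factorization 5) (Y.factorization 5) ((50 * w).factorization 5)
      (x / 5 ^ x.factorization 5 % 5) (Y / 5 ^ Y.factorization 5 % 5)
      (50 * w / 5 ^ (50 * w).factorization 5 % 5) Nat.prime_five).1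
    have hexp : ((x.factorization 5 + Y.factorization 5 + (50 * w).factorization 5 : ℕ) : ℝ) = 2 := by
      rw [fz h5x, fz h5Y, f50w5]; norm_num
    rw [hexp] at h
    have h' : c₁ * (2 * (2 : ℝ) - 6 - ε) * Real.log (5 : ℕ) ≤ (G₁ 5 : ℝ) := h
    have e : c₁ * (2 * (2 : ℝ) - 6 - ε) * Real.log (5 : ℕ) = -((2 + ε) * c₁ * Real.log (5 : ℕ)) := by ring
    linarith
  -- T⁻ at 2: exponents (0, 0, 5), UPPER window
  have f32w2 : (32 * w).factorization 2 = 5 := by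
    rw [fmr (by norm_num) hw0' h2w, show (32 : ℕ) = 2 ^ 5 by norm_num, fpp Nat.prime_two]
  have up_2 : (G₃ 2 : ℝ) ≤ 6 * K * Real.log (2 : ℕ) := by
    have h := hKt 2 (x.factorization 2) (y.factorization 2) ((32 * w).factorization 2)
      (x / 2 ^ x.factorization 2 % 2) (y / 2 ^ y.factorization 2 % 2)
      (32 * w / 2 ^ (32 * w).factorization 2 % 2) Nat.prime_two
    have hexp : ((x.factorization 2 + y.factorization 2 + (32 * w).factorization 2 : ℕ) : ℝ) = 5 := by
      rw [fz h2x, fz h2y, f32w2]; norm_num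
    rw [hexp] at h
    have h' : (G₃ 2 : ℝ) ≤ K * ((5 : ℝ) + 1) * Real.log (2 : ℕ) := (abs_le.mp h).2
    linarith
  -- T₂⁺: fourth-power atoms are nonnegative (X = r⁴ and 16W = (2q)⁴)
  have low4 := fun {p a b c : ℕ} (hp : p.Prime) (h4 : 4 ≤ a + b + c) =>
    table_nonneg_of_four_le hc₁ hε (fun p i j k r s z hp => (ht p i j k r s z hp).1) hp h4
      (X / p ^ a % p) (y / p ^ b % p) (16 * W / p ^ c % p)
  have nonneg_X : 0 ≤ ((∑ p ∈ X.primeFactors, G₂ p : ℤ) : ℝ) := by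
    push_cast
    refine Finset.sum_nonneg fun p hp => ?_
    have pp := Nat.prime_of_mem_primeFactors hp
    have hpX := Nat.dvd_of_mem_primeFactors hp
    refine low4 pp ?_
    have hpr : p ∣ r := pp.dvd_of_dvd_pow (hX ▸ hpX)
    have h1 : X.factorization p = 4 * r.factorization p := by
      rw [hX, Nat.factorization_pow, Finsupp.smul_apply, smul_eq_mul]
    have h2 : 1 ≤ r.factorization p := pp.factorization_pos_of_dvd hr0.ne' hpr
    omega
  have nonneg_W : 0 ≤ ((∑ p ∈ (16 * W).primeFactors, G₂ p : ℤ) : ℝ) := by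
    push_cast
    refine Finset.sum_nonneg fun p hp => ?_
    have pp := Nat.prime_of_mem_primeFactors hp
    have hpW := Nat.dvd_of_mem_primeFactors hp
    refine low4 pp ?_
    have e : 16 * W = (2 * q) ^ 4 := by rw [hW]; ring
    have hp2q : p ∣ 2 * q := pp.dvd_of_dvd_pow (e ▸ hpW)
    have h1 : (16 * W).factorization p = 4 * (2 * q).factorization p := by
      rw [e, Nat.factorization_pow, Finsupp.smul_apply, smul_eq_mul]
    have h2 : 1 ≤ (2 * q).factorization p := pp.factorization_pos_of_dvd (by omega) hp2q
    omega
  /- Step 6: the contradiction. -/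
  have hElimZ : (∑ p ∈ x.primeFactors, G₁ p) + G₁ s + (G₁ 2 + G₁ 5 + ∑ p ∈ w.primeFactors, G₁ p)
      + ((∑ p ∈ X.primeFactors, G₂ p) + (∑ p ∈ y.primeFactors, G₂ p) + ∑ p ∈ (16 * W).primeFactors, G₂ p)
      - ((∑ p ∈ x.primeFactors, G₃ p) + (∑ p ∈ y.primeFactors, G₃ p)
        + (G₃ 2 + ∑ p ∈ w.primeFactors, G₃ p)) = B₁ + B₂ - B₃ := by
    rw [← e₁, ← e₂, ← e₃, hE₁, hE₂, hE₃]
  rw [mx, my, mw] at hElimZ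
  have hElim : ((G₁ s : ℤ) : ℝ) + G₁ 2 + G₁ 5 + (∑ p ∈ X.primeFactors, G₂ p : ℤ)
      + (∑ p ∈ (16 * W).primeFactors, G₂ p : ℤ) - G₃ 2 = B₁ + B₂ - B₃ := by
    have h : (G₁ s + G₁ 2 + G₁ 5 + (∑ p ∈ X.primeFactors, G₂ p)
        + (∑ p ∈ (16 * W).primeFactors, G₂ p) - G₃ 2 : ℤ) = B₁ + B₂ - B₃ := by
      linear_combination hElimZ
    exact_mod_cast h
  have hB₁' := (abs_le.mp hB₁).2
  have hB₂' := (abs_le.mp hB₂).2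
  have hB₃' := (abs_le.mp hB₃).1
  have hc₃ := le_abs_self c₃
  have hC₀' : C₀ ≤ |C₀| := le_abs_self C₀
  have hDs : 0 ≤ D * Real.log s := mul_nonneg hD0.le (Real.log_natCast_nonneg s)
  linarith [low_s, low_2, low_5, up_2, nonneg_X, nonneg_W, hElim, hthr, hB₁', hB₂', hB₃', hc₃, hC₀', hC₀]

/-- **No quadratic-local tame-local receptacle** (the faithful typed face of branch (i) of crux
`ReceptacleIdentity`, stmt-ABC-1813, through `TameLocalReceptacle`, stmt-ABC-14354): the crux's
statement with the table additionally required to be QUADRATIC-LOCAL — at every odd prime `p` with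
`ℓ ∤ p − 1` the entry `t(p; i,j,k; r,s,z)` depends on `(r, s, z)` only through `(J(r|p), J(s|p), J(z|p))` —
is FALSE, unconditionally, on the `2⁻²⁵`-balanced cell and for every `ε < 2`; a witness of
`TameLocalReceptacle` must read unit residues beyond their quadratic characters at primes
`p ≢ 1 (mod ℓ)`, which no Kummer / local-Tate / Tate-curve local term does. [folklore] -/
theorem not_tameLocalReceptacle_quadraticLocal :
    ¬ (∀ κ : ℝ, 0 < κ → ∀ ε : ℝ, 0 < ε → ∃ c₁ c₁' c₃ : ℝ, 0 < c₁ ∧ ∃ m₀ : ℕ, ∀ ℓ n : ℕ, ℓ.Prime →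
      5 ≤ ℓ → m₀ ≤ ℓ ^ n → ∃ t : ℕ → ℕ → ℕ → ℕ → ℕ → ℕ → ℕ → ℤ,
        (∀ p i j k r s z : ℕ, p.Prime →
          c₁ * (2 * ((i + j + k : ℕ) : ℝ) - 6 - ε) * Real.log p ≤ (t p i j k r s z : ℝ) ∧
          |(t p i j k r s z : ℝ)| ≤ c₁' * (((i + j + k : ℕ) : ℝ) + 1) * Real.log p) ∧
        (∀ p : ℕ, p.Prime → p ≠ 2 → ¬ ℓ ∣ p - 1 → ∀ i j k r s z r' s' z' : ℕ,
          J((r : ℤ) | p) = J((r' : ℤ) | p) → J((s : ℤ) | p) = J((s' : ℤ) | p) →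
          J((z : ℤ) | p) = J((z' : ℤ) | p) → t p i j k r s z = t p i j k r' s' z') ∧
        ∀ a b c : ℕ, IsABCTriple a b c → κ * (c : ℝ) ≤ (a : ℝ) → κ * (c : ℝ) ≤ (b : ℝ) →
          ¬ ℓ ∣ a * b * c → ∃ B : ℤ, |(B : ℝ)| ≤ c₃ ∧
            (∑ p ∈ (a * b * c).primeFactors, t p (a.factorization p) (b.factorization p)
              (c.factorization p) (a / p ^ a.factorization p % p) (b / p ^ b.factorization p % p)
              (c / p ^ c.factorization p % p)) ≡ B [ZMOD ((ℓ ^ n : ℕ) : ℤ)]) := by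
  intro h
  obtain ⟨c₁, c₁', c₃, hc₁, m₀, H⟩ := h (1 / 2 ^ 25) (by positivity) 1 one_pos
  exact tameLocal_quadraticLocal_false (1 / 2 ^ 25) 1 c₁ c₁' c₃ le_rfl (by norm_num) hc₁ m₀ H

end Summit.ABC.ABC.Theorems.TameLocalReceptacle
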